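import Mathlib
import HarnessLib
import Literature.MathematicalPhysics.QuantumFieldTheory.Balaban1983to89.B13Contraction113

/-!
# B12 [Balaban1987RG1] p. 267 — the linearizing change of variables `B′ = B − hD̃(B)`: the algebra of the
# substitution, the fixed point `D̃` BY NAME from `B13Contraction113`, the explicit inverse `B′ ↦ B′ + hC̃(B′)`,
# `D̃⁽²⁾ = C̃⁽²⁾` as a third-order bound, and analyticity along complex lines

CITATION. T. Bałaban, *Renormalization group approach to lattice gauge field theories. I. Generation of effective
actions in a small field approximation and a coupling constant renormalization in four dimensions*, Commun. Math.
Phys. 109 (1987) 249–301 [Balaban1987RG1] ("B12" of the cell), p. 267 (renders `…1987-cmp109-rg-I-small-field-p019`,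
with p018, p020, p022 for the context quoted below; PDF page = journal page − 248).  The templates print refers to:
[15] = T. Bałaban, *The variational problem and background fields in renormalization group method for lattice gauge
theories*, CMP 102 (1985) 277–309, Sect. C [Balaban1985Variational]; [14] = T. Bałaban, *Spaces of regular gauge
field configurations on a lattice and gauge fixing conditions*, CMP 99 (1985) 75–102, Sect. E
[Balaban1985RegularSpaces] (both as listed in B12's references, p. 299 [PDF 51]).  The kernel scheme of [15] Sect. C
is the tree module `B13Contraction113` (abstract complex normed spaces), which this file imports and instantiates BY
NAME; nothing of it is re-derived (the kernel of [14] Sect. E is `B8SectE`, not imported).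

THE PRINT (B12 p. 267 [PDF 19], verbatim).  After (2.10): *«In this integral we make a change of variables linearizing
the function Q̃(B′). This operation was discussed several times in the previous papers, e.g. see Sect. C [15],
Sect. E [14]. Here we have a particularly simple unit lattice situation. At first we introduce an operator h. It
transforms 𝐠-valued functions B defined at bonds of the lattice T⁽ᵏ⁺¹⁾ into such functions defined at bonds of T⁽ᵏ⁾.
The function hB is equal to 0 everywhere, except the set {b₀(c) : c ∈ T⁽ᵏ⁺¹⁾}. […] Furthermore, the operator h
satisfies the identity LQ̃h = I on T⁽ᵏ⁺¹⁾. Of course h is uniquely defined by these conditions, in fact it is a very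
simple operator given by the equality (hB)(b₀(c)) = h(c)B(c), where h(c) is a linear operator on the Lie algebra 𝐠,
equal to an inverse of a coefficient at the variable B′(b₀(c)) in (Q̃B′)(c), multiplied by L⁻¹. We are looking for an
analytic, 𝐠-valued function D̃(B′), defined at bonds of T⁽ᵏ⁺¹⁾, and such that the transformation B′ = B − hD̃(B)
linearizes the function Q̃(B′). The function D̃(B) is determined by the equation LQ̃B′ + C̃(B′) = LQ̃B − D̃(B) +
C̃(B − hD̃(B)) = LQ̃B. It is easy to prove, following the proofs in the above mentioned papers, that there exists
exactly one solution of this equation, and that it is an analytic function of B. From this equation we obtain also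
that D̃(B) has an expansion beginning with quadratic terms, and D̃⁽²⁾(B) = C̃⁽²⁾(B). The above change of variables
yields the integral with the δ-function δ(Q̃B).»*  Context: p. 266 (2.4) *«The expression under the δ-function is
equal to M(V′V⁽ᵏ⁾)M(V⁽ᵏ⁾)⁻¹ = exp iQ̃(B′). (2.4)»*; consumers p. 268 (2.12) *«Tr log(I − h((δ/δB)D̃)(g_kCB))»*,
*«+ log σ(g_kCB − hD̃(g_kCB))»*, and p. 270 *«Let us denote for simplicity the expression under the exponential in
{…} by B′, i.e., B′ = g_kCB − hD̃(g_kCB). (3.2)»*.  Print sets the Lie algebra in bold (`𝐠`).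

THE TYPING (schematic, over abstract complex normed spaces — cell DIVERGENCE row for this file).  `𝒴` = the space
of (complexified) configurations `B′, B` on bonds of `T⁽ᵏ⁾`, `𝒳` = the space of configurations on bonds of
`T⁽ᵏ⁺¹⁾` (one `𝐠ᶜ` value per coarse bond `c`; complete).  DATA: a linear `LQ : 𝒴 →ₗ 𝒳` (print's `LQ̃`, the
linear member of the display), a map `Ct : 𝒴 → 𝒳` (print's `C̃`; the constraint function of the δ-function is the
left member of the display, `B′ ↦ LQ B′ + Ct B′`), a linear `hop : 𝒳 →ₗ 𝒴` (print's `h`) with `LQ (hop X) = X`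
(print's «LQ̃h = I»).  The substitution is `Φ B = B − hop (D̃ B)`; `D̃ B` is THE fixed point of `X ↦ Ct (B − hop X)`
— literally the map of `B13Contraction113` (dictionary `A′ ↦ B`, `H ↦ h`, `C ↦ C̃`, `L^jη ↦ 1`: «a particularly
simple unit lattice situation»).  HYPOTHESES, never asserted: `QuadAnalytic Ct C₂ R` (the quadratic bound `‖C̃(Y)‖ ≤
C₂‖Y‖²` on `‖Y‖ < R` and analyticity along complex lines — cell GAPS G-adv9-22 (U1)), `‖hop X‖ ≤ b‖X‖` ((U2)), the
contraction condition `9C₂bε < 1` and `3ε ≤ R` of `B13Contraction113` ([15] p. 286 «contractive if 9C₂B₀ε₃ < 1»).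
`D̃` enters HYPOTHESIS-STYLE as any function `Dt : 𝒴 → 𝒳` with `Dt B ∈ closedBall 0 (4C₂ε²)` and
`Ct (B − hop (Dt B)) = Dt B` for `‖B‖ < ε` (`exists_Dt` produces one; `eq_Dt_of_fixedPt` says it is unique).

CONTENTS.  §1 [folklore] the algebra over any ring: the substitution linearizes iff the fixed-point equation holds
(`linearizes`, `fixedPt_of_linearizes`); the EXPLICIT INVERSE `Ψ B′ = B′ + hop (Ct B′)`: `LQ (Ψ B′) = LQ B′ + Ct B′`,
`Ψ (Φ B) = B` from the fixed-point identity alone, `Ct B′` solves the fixed-point equation at the point `Ψ B′`, hence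
`Φ (Ψ B′) = B′` wherever `D̃(Ψ B′)` is that solution; injectivity of `Φ` on any set where the identity holds.  §2
[folklore] the fixed point in the ball: existence of a `Dt` (`exists_Dt`, Mathlib choice over
`B13Contraction113.exists_unique_fixedPoint`), uniqueness, `‖Dt B‖ ≤ 4C₂‖B‖²` (`bound_114` by name), the
third-order agreement `‖Dt B − Ct B‖ ≤ 36C₂²b‖B‖³` (print's «D̃⁽²⁾(B) = C̃⁽²⁾(B)», from `lipschitz_T` between `Dt B`
and `0` and `ε ↓ ‖B‖`), invariance of a closed `T`-stable set (e.g. the real configurations), and the change of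
variables on balls: `Φ` is injective on `‖B‖ < ε`, maps it into `‖B′‖ < 2ε`, its image contains `‖B′‖ < ε/2`, with
inverse `Ψ` there (`phi_psi_of_norm_lt`, `existsUnique_phi_eq`) — the bijectivity part of cell GAPS G-adv9-22 (U4)
(whose injectivity argument used a Lipschitz bound on `D̃`; here the left inverse `Ψ` does it, with no further
smallness) and the unit-lattice form of the onto-ness claim of [14] Sect. E p. 97 (cell GAPS G-B8-05; the kernel
`B8SectE.onto_of_lipschitz_half` runs a second contraction — none is needed here).  §3 [folklore] analyticity of
`σ ↦ Dt (P + σ•Q)` on `{σ : ‖P + σ•Q‖ < ε}` for Fréchet-holomorphic `Ct` (`B13Contraction113.analytic_fixedPoint_113`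
by name + uniqueness; a Fréchet-holomorphic `Ct` with the quadratic bound is `QuadAnalytic` by
`B11Prop6Scheme.Prop4Hyp.quadAnalytic`, not imported) and the smallness arithmetic `18C₂bε ≤ 1 ⇒ 9C₂bε < 1 ∧
4C₂bε ≤ 1`.  (The sibling `B13GaugeDevices.solD` is a background-dependent `def` of the same chosen fixed point; this
file stays hypothesis-style and `def`-free.)  §4 ONE transcription theorem [cite] assembling the p. 267 paragraph
in this typing, and a degenerate model showing its seven hypotheses are jointly satisfiable.  NOT TYPED: joint (Fréchet) analyticity of `D̃` in
`B` (print's «analytic function of B»; only complex lines here), the Jacobian `Tr log(I − h(δD̃/δB))` of (2.12), the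
lattice formula `(hB)(b₀(c)) = h(c)B(c)` and the uniqueness of `h` (kernel elsewhere: `B13PkLocalTerms.hOp_apply_b₀`),
the sizes of the real domains ((2.9), cell SMALLNESS S-B12.22).  Everything is [folklore] functional analysis except
§4; nothing of [B12] is asserted; NOT summit progress.
-/

open Metric Set Filter Topology

namespace Literature.MathematicalPhysics.QuantumFieldTheory.Balaban1983to89.B12Lineariz267

open Literature.MathematicalPhysics.QuantumFieldTheory.Balaban1983to89.B13Contraction113

/-! ## §1  The algebra of the substitution `B′ = B − hD` and its explicit inverse `B′ ↦ B′ + hC̃(B′)` -/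

section algebra

variable {𝕜 : Type*} [Ring 𝕜] {𝒳 𝒴 : Type*} [AddCommGroup 𝒳] [Module 𝕜 𝒳] [AddCommGroup 𝒴] [Module 𝕜 𝒴]
  {LQ : 𝒴 →ₗ[𝕜] 𝒳} {hop : 𝒳 →ₗ[𝕜] 𝒴} {Ct : 𝒴 → 𝒳}

/-- **The displayed equation of p. 267, read left to right**: if `D` solves the fixed-point equation
`C̃(B − hD) = D`, then `B′ = B − hD` linearizes: `LQ̃B′ + C̃(B′) = LQ̃B − D + C̃(B − hD) = LQ̃B` (uses only
«LQ̃h = I»). [folklore] -/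
theorem linearizes (hLQh : ∀ X, LQ (hop X) = X) {B : 𝒴} {D : 𝒳} (hfix : Ct (B - hop D) = D) :
    LQ (B - hop D) + Ct (B - hop D) = LQ B := by
  rw [map_sub, hLQh, hfix]; abel

/-- Conversely: if the substitution `B′ = B − hD` linearizes, then `D` solves the fixed-point equation — print's
«The function D̃(B) is determined by the equation». [folklore] -/
theorem fixedPt_of_linearizes (hLQh : ∀ X, LQ (hop X) = X) {B : 𝒴} {D : 𝒳}
    (hlin : LQ (B - hop D) + Ct (B - hop D) = LQ B) : Ct (B - hop D) = D := by
  rw [map_sub, hLQh] at hlin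
  calc Ct (B - hop D) = (LQ B - D + Ct (B - hop D)) - LQ B + D := by abel
    _ = LQ B - LQ B + D := by rw [hlin]
    _ = D := by abel

/-- The two readings are equivalent. [folklore] -/
theorem linearizes_iff (hLQh : ∀ X, LQ (hop X) = X) (B : 𝒴) (D : 𝒳) :
    LQ (B - hop D) + Ct (B - hop D) = LQ B ↔ Ct (B - hop D) = D :=
  ⟨fixedPt_of_linearizes hLQh, linearizes hLQh⟩

/-- **The explicit inverse, I**: `LQ̃(B′ + hC̃(B′)) = LQ̃B′ + C̃(B′)` — the map `Ψ B′ = B′ + hC̃(B′)` pulls the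
linear function `LQ̃` back to the constraint function; in particular `LQ̃B′ + C̃(B′) = 0 ↔ LQ̃(Ψ B′) = 0` (the
δ-surface is the `Ψ`-preimage of the linear subspace). [folklore] -/
theorem LQ_psi (hLQh : ∀ X, LQ (hop X) = X) (B' : 𝒴) : LQ (B' + hop (Ct B')) = LQ B' + Ct B' := by
  rw [map_add, hLQh]

/-- The δ-surface `{LQ̃B′ + C̃(B′) = 0}` is the `Ψ`-preimage of the linear subspace `{LQ̃ = 0}`. [folklore] -/
theorem constraint_eq_zero_iff (hLQh : ∀ X, LQ (hop X) = X) (B' : 𝒴) :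
    LQ B' + Ct B' = 0 ↔ LQ (B' + hop (Ct B')) = 0 := by
  rw [LQ_psi hLQh]

/-- **The explicit inverse, II**: `Ψ(Φ B) = B` from the fixed-point identity ALONE:
`(B − hD) + hC̃(B − hD) = B − hD + hD = B`. [folklore] -/
theorem psi_phi {B : 𝒴} {D : 𝒳} (hfix : Ct (B - hop D) = D) : (B - hop D) + hop (Ct (B - hop D)) = B := by
  rw [hfix]; abel

/-- `Ψ B′ − hC̃(B′) = B′`. [folklore] -/
theorem psi_sub_hop (B' : 𝒴) : (B' + hop (Ct B')) - hop (Ct B') = B' := by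
  abel

/-- **The explicit inverse, III**: `X = C̃(B′)` solves the fixed-point equation `C̃(B − hX) = X` at the point
`B = Ψ B′ = B′ + hC̃(B′)`. [folklore] -/
theorem fixedPt_at_psi (B' : 𝒴) : Ct ((B' + hop (Ct B')) - hop (Ct B')) = Ct B' := by
  rw [psi_sub_hop]

/-- Hence `Φ(Ψ B′) = B′` as soon as `D̃(Ψ B′)` is that solution (which uniqueness in the ball gives, §2). [folklore] -/
theorem phi_psi {Dt : 𝒴 → 𝒳} {B' : 𝒴} (hD : Dt (B' + hop (Ct B')) = Ct B') :
    (B' + hop (Ct B')) - hop (Dt (B' + hop (Ct B'))) = B' := by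
  rw [hD]; abel

/-- **Injectivity of `Φ B = B − hD̃(B)`** on any set on which the fixed-point identity holds — from the left
inverse `Ψ`, with no Lipschitz bound on `D̃` (cell GAPS G-adv9-22 (U4) used one). [folklore] -/
theorem injOn_phi {Dt : 𝒴 → 𝒳} {s : Set 𝒴} (hfix : ∀ B ∈ s, Ct (B - hop (Dt B)) = Dt B) :
    InjOn (fun B => B - hop (Dt B)) s := by
  intro B₁ h₁ B₂ h₂ heq
  have heq' : B₁ - hop (Dt B₁) = B₂ - hop (Dt B₂) := heq
  calc B₁ = (B₁ - hop (Dt B₁)) + hop (Ct (B₁ - hop (Dt B₁))) := (psi_phi (hfix B₁ h₁)).symm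
    _ = (B₂ - hop (Dt B₂)) + hop (Ct (B₂ - hop (Dt B₂))) := by rw [heq']
    _ = B₂ := psi_phi (hfix B₂ h₂)

end algebra

/-! ## §2  The fixed point `D̃` in the ball (by name from `B13Contraction113`) and the change of variables -/

section fixedPoint

variable {𝒳 𝒴 : Type*} [NormedAddCommGroup 𝒳] [NormedSpace ℂ 𝒳] [CompleteSpace 𝒳]
  [NormedAddCommGroup 𝒴] [NormedSpace ℂ 𝒴]
  {LQ : 𝒴 →ₗ[ℂ] 𝒳} {hop : 𝒳 →ₗ[ℂ] 𝒴} {Ct : 𝒴 → 𝒳} {C₂ R b ε : ℝ} {Dt : 𝒴 → 𝒳}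

/-- **«there exists exactly one solution of this equation» — existence of the function `D̃`** on `‖B‖ < ε`,
valued in the closed ball `4C₂ε²`: Mathlib choice over `B13Contraction113.exists_unique_fixedPoint` (the
contraction mapping theorem under `9C₂bε < 1`, `3ε ≤ R`). [folklore] -/
theorem exists_Dt (hC : QuadAnalytic Ct C₂ R) (hC₂ : 0 ≤ C₂) (hb : 0 ≤ b)
    (hHop : ∀ X, ‖hop X‖ ≤ b * ‖X‖) (hq : 9 * C₂ * b * ε < 1) (hRC : 3 * ε ≤ R) :
    ∃ Dt : 𝒴 → 𝒳, ∀ B : 𝒴, ‖B‖ < ε →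
      Dt B ∈ closedBall (0:𝒳) (4 * C₂ * ε ^ 2) ∧ Ct (B - hop (Dt B)) = Dt B := by
  classical
  refine ⟨fun B => if hB : ‖B‖ < ε then
      Classical.choose (exists_unique_fixedPoint hC hC₂ hb hHop hB hq hRC) else 0, fun B hB => ?_⟩
  simp only [dif_pos hB]
  obtain ⟨hmem, hfix, -⟩ := Classical.choose_spec (exists_unique_fixedPoint hC hC₂ hb hHop hB hq hRC)
  exact ⟨hmem, hfix⟩

/-- **«exactly one solution» — uniqueness**: any solution of `C̃(B − hX) = X` in the closed ball `4C₂ε²` is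
`D̃(B)`. [folklore] -/
theorem eq_Dt_of_fixedPt (hC : QuadAnalytic Ct C₂ R) (hC₂ : 0 ≤ C₂) (hb : 0 ≤ b)
    (hHop : ∀ X, ‖hop X‖ ≤ b * ‖X‖) (hq : 9 * C₂ * b * ε < 1) (hRC : 3 * ε ≤ R)
    (hDball : ∀ B : 𝒴, ‖B‖ < ε → Dt B ∈ closedBall (0:𝒳) (4 * C₂ * ε ^ 2))
    (hDfix : ∀ B : 𝒴, ‖B‖ < ε → Ct (B - hop (Dt B)) = Dt B)
    {B : 𝒴} (hB : ‖B‖ < ε) {X : 𝒳} (hX : X ∈ closedBall (0:𝒳) (4 * C₂ * ε ^ 2))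
    (hXfix : Ct (B - hop X) = X) : X = Dt B := by
  obtain ⟨X₀, -, -, huniq⟩ := exists_unique_fixedPoint hC hC₂ hb hHop hB hq hRC
  rw [huniq X hX hXfix, huniq (Dt B) (hDball B hB) (hDfix B hB)]

/-- Two functions `D̃` as above agree on `‖B‖ < ε` («exactly one solution», function form). [folklore] -/
theorem Dt_unique (hC : QuadAnalytic Ct C₂ R) (hC₂ : 0 ≤ C₂) (hb : 0 ≤ b)
    (hHop : ∀ X, ‖hop X‖ ≤ b * ‖X‖) (hq : 9 * C₂ * b * ε < 1) (hRC : 3 * ε ≤ R)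
    {Dt₁ Dt₂ : 𝒴 → 𝒳}
    (h₁ball : ∀ B : 𝒴, ‖B‖ < ε → Dt₁ B ∈ closedBall (0:𝒳) (4 * C₂ * ε ^ 2))
    (h₁fix : ∀ B : 𝒴, ‖B‖ < ε → Ct (B - hop (Dt₁ B)) = Dt₁ B)
    (h₂ball : ∀ B : 𝒴, ‖B‖ < ε → Dt₂ B ∈ closedBall (0:𝒳) (4 * C₂ * ε ^ 2))
    (h₂fix : ∀ B : 𝒴, ‖B‖ < ε → Ct (B - hop (Dt₂ B)) = Dt₂ B) {B : 𝒴} (hB : ‖B‖ < ε) :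
    Dt₁ B = Dt₂ B :=
  eq_Dt_of_fixedPt hC hC₂ hb hHop hq hRC h₂ball h₂fix hB (h₁ball B hB) (h₁fix B hB)

/-- **«D̃(B) has an expansion beginning with quadratic terms»**: `‖D̃(B)‖ ≤ 4C₂‖B‖²` —
`B13Contraction113.bound_114` ([15] (55)) by name. [folklore] -/
theorem norm_Dt_le (hC : QuadAnalytic Ct C₂ R) (hC₂ : 0 ≤ C₂) (hb : 0 ≤ b)
    (hHop : ∀ X, ‖hop X‖ ≤ b * ‖X‖) (hq : 9 * C₂ * b * ε < 1) (hRC : 3 * ε ≤ R)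
    (hDball : ∀ B : 𝒴, ‖B‖ < ε → Dt B ∈ closedBall (0:𝒳) (4 * C₂ * ε ^ 2))
    (hDfix : ∀ B : 𝒴, ‖B‖ < ε → Ct (B - hop (Dt B)) = Dt B) {B : 𝒴} (hB : ‖B‖ < ε) :
    ‖Dt B‖ ≤ 4 * C₂ * ‖B‖ ^ 2 :=
  bound_114 hC hC₂ hb hHop hB hq hRC (hDball B hB) (hDfix B hB)

/-- **«and D̃⁽²⁾(B) = C̃⁽²⁾(B)» as a third-order bound**: `‖D̃(B) − C̃(B)‖ ≤ 36C₂²b‖B‖³` for `‖B‖ < ε` (the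
template is [15] p. 286: *«This implies that a power series expansion of D(A′) begins with second order terms. …
D⁽²⁾(A′) = C_j⁽²⁾(L^jηA′)»*).  Proof: `D̃(B) − C̃(B) = C̃(B − hD̃(B)) − C̃(B − h0)`, so by the Lipschitz estimate of
the contraction (`B13Contraction113.lipschitz_T`, [15] (54)) at every admissible radius `ε′ ∈ (‖B‖, ε]` it is
bounded by `9C₂bε′‖D̃(B)‖ ≤ 9C₂bε′·4C₂‖B‖²`; let `ε′ ↓ ‖B‖`. [folklore] -/
theorem norm_Dt_sub_Ct_le (hC : QuadAnalytic Ct C₂ R) (hC₂ : 0 ≤ C₂) (hb : 0 ≤ b)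
    (hHop : ∀ X, ‖hop X‖ ≤ b * ‖X‖) (hq : 9 * C₂ * b * ε < 1) (hRC : 3 * ε ≤ R)
    (hDball : ∀ B : 𝒴, ‖B‖ < ε → Dt B ∈ closedBall (0:𝒳) (4 * C₂ * ε ^ 2))
    (hDfix : ∀ B : 𝒴, ‖B‖ < ε → Ct (B - hop (Dt B)) = Dt B) {B : 𝒴} (hB : ‖B‖ < ε) :
    ‖Dt B - Ct B‖ ≤ 36 * C₂ ^ 2 * b * ‖B‖ ^ 3 := by
  have hX : ‖Dt B‖ ≤ 4 * C₂ * ‖B‖ ^ 2 := norm_Dt_le hC hC₂ hb hHop hq hRC hDball hDfix hB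
  have h9 : 0 ≤ 9 * C₂ * b := by positivity
  -- the bound at every admissible radius ε' ∈ (‖B‖, ε]
  have hstep : ∀ ε' ∈ Ioc ‖B‖ ε, ‖Dt B - Ct B‖ ≤ 9 * C₂ * b * ε' * (4 * C₂ * ‖B‖ ^ 2) := by
    intro ε' hε'
    have hε'0 : 0 ≤ ε' := (norm_nonneg _).trans hε'.1.le
    have hq' : 9 * C₂ * b * ε' < 1 :=
      lt_of_le_of_lt (by nlinarith [mul_le_mul_of_nonneg_left hε'.2 h9]) hq
    have hR2' : 4 * C₂ * b * ε' ≤ 1 := by nlinarith [mul_nonneg h9 hε'0]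
    have hRC' : 3 * ε' ≤ R := by linarith [hε'.2]
    have hmem : Dt B ∈ closedBall (0:𝒳) (4 * C₂ * ε' ^ 2) := by
      rw [mem_closedBall, dist_zero_right]
      exact hX.trans (mul_le_mul_of_nonneg_left (pow_le_pow_left₀ (norm_nonneg _) hε'.1.le 2)
        (by positivity))
    have h0 : (0:𝒳) ∈ closedBall (0:𝒳) (4 * C₂ * ε' ^ 2) := by
      rw [mem_closedBall, dist_zero_right, norm_zero]; positivity
    have hlip := lipschitz_T hC hC₂ hb hHop hε'.1 hR2' hRC' hmem h0
    rw [map_zero, sub_zero, sub_zero, hDfix B hB] at hlip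
    exact hlip.trans (mul_le_mul_of_nonneg_left hX (mul_nonneg h9 hε'0))
  -- let ε' ↓ ‖B‖
  have hcont : Tendsto (fun ε' : ℝ => 9 * C₂ * b * ε' * (4 * C₂ * ‖B‖ ^ 2)) (𝓝[>] ‖B‖)
      (𝓝 (9 * C₂ * b * ‖B‖ * (4 * C₂ * ‖B‖ ^ 2))) := by
    have hc : Continuous fun ε' : ℝ => 9 * C₂ * b * ε' * (4 * C₂ * ‖B‖ ^ 2) := by continuity
    exact (hc.tendsto _).mono_left nhdsWithin_le_nhds
  have hle : ‖Dt B - Ct B‖ ≤ 9 * C₂ * b * ‖B‖ * (4 * C₂ * ‖B‖ ^ 2) :=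
    ge_of_tendsto hcont (by filter_upwards [Ioc_mem_nhdsGT hB] with ε' hε' using hstep ε' hε')
  calc ‖Dt B - Ct B‖ ≤ 9 * C₂ * b * ‖B‖ * (4 * C₂ * ‖B‖ ^ 2) := hle
    _ = 36 * C₂ ^ 2 * b * ‖B‖ ^ 3 := by ring

omit [CompleteSpace 𝒳] in
/-- **«the transformation B′ = B − hD̃(B) linearizes the function Q̃(B′)»**: for `‖B‖ < ε`,
`LQ̃(Φ B) + C̃(Φ B) = LQ̃B`. [folklore] -/
theorem linearizes_Dt (hLQh : ∀ X, LQ (hop X) = X)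
    (hDfix : ∀ B : 𝒴, ‖B‖ < ε → Ct (B - hop (Dt B)) = Dt B) {B : 𝒴} (hB : ‖B‖ < ε) :
    LQ (B - hop (Dt B)) + Ct (B - hop (Dt B)) = LQ B :=
  linearizes hLQh (hDfix B hB)

/-- The size of the correction: `‖hD̃(B)‖ ≤ 4C₂b‖B‖²` and `≤ ε` (the latter is `B13Contraction113.norm_Hop_le`,
self-map condition `4C₂bε ≤ 1`, implied by `9C₂bε < 1`). [folklore] -/
theorem norm_hop_Dt_le (hC : QuadAnalytic Ct C₂ R) (hC₂ : 0 ≤ C₂) (hb : 0 ≤ b)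
    (hHop : ∀ X, ‖hop X‖ ≤ b * ‖X‖) (hq : 9 * C₂ * b * ε < 1) (hRC : 3 * ε ≤ R)
    (hDball : ∀ B : 𝒴, ‖B‖ < ε → Dt B ∈ closedBall (0:𝒳) (4 * C₂ * ε ^ 2))
    (hDfix : ∀ B : 𝒴, ‖B‖ < ε → Ct (B - hop (Dt B)) = Dt B) {B : 𝒴} (hB : ‖B‖ < ε) :
    ‖hop (Dt B)‖ ≤ 4 * C₂ * b * ‖B‖ ^ 2 ∧ ‖hop (Dt B)‖ ≤ ε := by
  have hε : 0 ≤ ε := (norm_nonneg _).trans hB.le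
  have h9 : 0 ≤ 9 * C₂ * b := by positivity
  have hR2 : 4 * C₂ * b * ε ≤ 1 := by nlinarith [mul_nonneg h9 hε]
  refine ⟨?_, norm_Hop_le hb hε hHop hR2 (hDball B hB)⟩
  calc ‖hop (Dt B)‖ ≤ b * ‖Dt B‖ := hHop _
    _ ≤ b * (4 * C₂ * ‖B‖ ^ 2) :=
        mul_le_mul_of_nonneg_left (norm_Dt_le hC hC₂ hb hHop hq hRC hDball hDfix hB) hb
    _ = 4 * C₂ * b * ‖B‖ ^ 2 := by ring

/-- `Φ` maps the ball `‖B‖ < ε` into the ball `‖B′‖ < 2ε`. [folklore] -/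
theorem mapsTo_phi (hC : QuadAnalytic Ct C₂ R) (hC₂ : 0 ≤ C₂) (hb : 0 ≤ b)
    (hHop : ∀ X, ‖hop X‖ ≤ b * ‖X‖) (hq : 9 * C₂ * b * ε < 1) (hRC : 3 * ε ≤ R)
    (hDball : ∀ B : 𝒴, ‖B‖ < ε → Dt B ∈ closedBall (0:𝒳) (4 * C₂ * ε ^ 2))
    (hDfix : ∀ B : 𝒴, ‖B‖ < ε → Ct (B - hop (Dt B)) = Dt B) :
    MapsTo (fun B => B - hop (Dt B)) (ball (0:𝒴) ε) (ball (0:𝒴) (2 * ε)) := by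
  intro B hB
  rw [mem_ball_zero_iff] at hB ⊢
  have h2 := (norm_hop_Dt_le hC hC₂ hb hHop hq hRC hDball hDfix hB).2
  calc ‖B - hop (Dt B)‖ ≤ ‖B‖ + ‖hop (Dt B)‖ := norm_sub_le _ _
    _ < ε + ε := add_lt_add_of_lt_of_le hB h2
    _ = 2 * ε := by ring

omit [CompleteSpace 𝒳] in
/-- **`Φ` is injective on `‖B‖ < ε`** (left inverse `Ψ`, §1). [folklore] -/
theorem injOn_phi_ball (hDfix : ∀ B : 𝒴, ‖B‖ < ε → Ct (B - hop (Dt B)) = Dt B) :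
    InjOn (fun B => B - hop (Dt B)) (ball (0:𝒴) ε) :=
  injOn_phi fun B hB => hDfix B (mem_ball_zero_iff.mp hB)

/-- **`D̃(Ψ B′) = C̃(B′)`** whenever `Ψ B′ = B′ + hC̃(B′)` lies in the domain `‖·‖ < ε` and `C̃(B′)` in the
uniqueness ball `4C₂ε²` (uniqueness, since `C̃(B′)` solves the equation at `Ψ B′`, §1). [folklore] -/
theorem Dt_psi (hC : QuadAnalytic Ct C₂ R) (hC₂ : 0 ≤ C₂) (hb : 0 ≤ b)
    (hHop : ∀ X, ‖hop X‖ ≤ b * ‖X‖) (hq : 9 * C₂ * b * ε < 1) (hRC : 3 * ε ≤ R)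
    (hDball : ∀ B : 𝒴, ‖B‖ < ε → Dt B ∈ closedBall (0:𝒳) (4 * C₂ * ε ^ 2))
    (hDfix : ∀ B : 𝒴, ‖B‖ < ε → Ct (B - hop (Dt B)) = Dt B)
    {B' : 𝒴} (hΨ : ‖B' + hop (Ct B')‖ < ε) (hCt : Ct B' ∈ closedBall (0:𝒳) (4 * C₂ * ε ^ 2)) :
    Dt (B' + hop (Ct B')) = Ct B' :=
  (eq_Dt_of_fixedPt hC hC₂ hb hHop hq hRC hDball hDfix hΨ hCt (fixedPt_at_psi B')).symm

omit [CompleteSpace 𝒳] in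
/-- For `‖B′‖ < ε/2` the point `Ψ B′` lies in the domain and `C̃(B′)` in the uniqueness ball:
`‖Ψ B′‖ ≤ ‖B′‖ + bC₂‖B′‖² < ε/2 + bC₂ε²/4 < ε` (as `9C₂bε < 1`) and `‖C̃(B′)‖ ≤ C₂ε²/4 ≤ 4C₂ε²`. [folklore] -/
theorem psi_mem_of_norm_lt (hC : QuadAnalytic Ct C₂ R) (hC₂ : 0 ≤ C₂) (hb : 0 ≤ b)
    (hHop : ∀ X, ‖hop X‖ ≤ b * ‖X‖) (hq : 9 * C₂ * b * ε < 1) (hRC : 3 * ε ≤ R)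
    {B' : 𝒴} (hB' : ‖B'‖ < ε / 2) :
    ‖B' + hop (Ct B')‖ < ε ∧ Ct B' ∈ closedBall (0:𝒳) (4 * C₂ * ε ^ 2) := by
  have hε : 0 < ε := by linarith [norm_nonneg B']
  have hR : ‖B'‖ < R := by linarith
  have hCt : ‖Ct B'‖ ≤ C₂ * ‖B'‖ ^ 2 := hC.quad B' hR
  have hsq : ‖B'‖ ^ 2 ≤ (ε / 2) ^ 2 := pow_le_pow_left₀ (norm_nonneg _) hB'.le 2
  have hCt' : ‖Ct B'‖ ≤ C₂ * (ε / 2) ^ 2 := hCt.trans (mul_le_mul_of_nonneg_left hsq hC₂)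
  refine ⟨?_, ?_⟩
  · have hh : ‖hop (Ct B')‖ ≤ b * (C₂ * (ε / 2) ^ 2) :=
      (hHop _).trans (mul_le_mul_of_nonneg_left hCt' hb)
    have hsmall : b * (C₂ * (ε / 2) ^ 2) < ε / 2 := by nlinarith
    calc ‖B' + hop (Ct B')‖ ≤ ‖B'‖ + ‖hop (Ct B')‖ := norm_add_le _ _
      _ < ε / 2 + ε / 2 := add_lt_add hB' (hh.trans_lt hsmall)
      _ = ε := by ring
  · rw [mem_closedBall, dist_zero_right]
    calc ‖Ct B'‖ ≤ C₂ * (ε / 2) ^ 2 := hCt'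
      _ ≤ 4 * C₂ * ε ^ 2 := by nlinarith [sq_nonneg ε]

/-- **`Φ(Ψ B′) = B′` for `‖B′‖ < ε/2`**, with `‖Ψ B′‖ < ε` — the "onto" step: every `B′` in the half-ball is the
image under `Φ` of the point `Ψ B′ = B′ + hC̃(B′)` of the domain (cell GAPS G-adv9-22 (U4); the unit-lattice case of
the onto-ness claim of [14] Sect. E p. 97, cell GAPS G-B8-05). [folklore] -/
theorem phi_psi_of_norm_lt (hC : QuadAnalytic Ct C₂ R) (hC₂ : 0 ≤ C₂) (hb : 0 ≤ b)
    (hHop : ∀ X, ‖hop X‖ ≤ b * ‖X‖) (hq : 9 * C₂ * b * ε < 1) (hRC : 3 * ε ≤ R)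
    (hDball : ∀ B : 𝒴, ‖B‖ < ε → Dt B ∈ closedBall (0:𝒳) (4 * C₂ * ε ^ 2))
    (hDfix : ∀ B : 𝒴, ‖B‖ < ε → Ct (B - hop (Dt B)) = Dt B) {B' : 𝒴} (hB' : ‖B'‖ < ε / 2) :
    ‖B' + hop (Ct B')‖ < ε ∧ (B' + hop (Ct B')) - hop (Dt (B' + hop (Ct B'))) = B' := by
  obtain ⟨hΨ, hCt⟩ := psi_mem_of_norm_lt hC hC₂ hb hHop hq hRC hB'
  exact ⟨hΨ, phi_psi (Dt_psi hC hC₂ hb hHop hq hRC hDball hDfix hΨ hCt)⟩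

/-- The image of the domain `‖B‖ < ε` under `Φ` contains the half-ball `‖B′‖ < ε/2`. [folklore] -/
theorem ball_half_subset_image_phi (hC : QuadAnalytic Ct C₂ R) (hC₂ : 0 ≤ C₂) (hb : 0 ≤ b)
    (hHop : ∀ X, ‖hop X‖ ≤ b * ‖X‖) (hq : 9 * C₂ * b * ε < 1) (hRC : 3 * ε ≤ R)
    (hDball : ∀ B : 𝒴, ‖B‖ < ε → Dt B ∈ closedBall (0:𝒳) (4 * C₂ * ε ^ 2))
    (hDfix : ∀ B : 𝒴, ‖B‖ < ε → Ct (B - hop (Dt B)) = Dt B) :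
    ball (0:𝒴) (ε / 2) ⊆ (fun B => B - hop (Dt B)) '' ball (0:𝒴) ε := by
  intro B' hB'
  rw [mem_ball_zero_iff] at hB'
  obtain ⟨hΨ, hΦΨ⟩ := phi_psi_of_norm_lt hC hC₂ hb hHop hq hRC hDball hDfix hB'
  exact ⟨B' + hop (Ct B'), mem_ball_zero_iff.mpr hΨ, hΦΨ⟩

/-- **The change of variables on balls**: every `B′` with `‖B′‖ < ε/2` has EXACTLY ONE preimage `B` with
`‖B‖ < ε` under `Φ B = B − hD̃(B)`, namely `B = B′ + hC̃(B′)`. [folklore] -/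
theorem existsUnique_phi_eq (hC : QuadAnalytic Ct C₂ R) (hC₂ : 0 ≤ C₂) (hb : 0 ≤ b)
    (hHop : ∀ X, ‖hop X‖ ≤ b * ‖X‖) (hq : 9 * C₂ * b * ε < 1) (hRC : 3 * ε ≤ R)
    (hDball : ∀ B : 𝒴, ‖B‖ < ε → Dt B ∈ closedBall (0:𝒳) (4 * C₂ * ε ^ 2))
    (hDfix : ∀ B : 𝒴, ‖B‖ < ε → Ct (B - hop (Dt B)) = Dt B) {B' : 𝒴} (hB' : ‖B'‖ < ε / 2) :
    ∃! B : 𝒴, ‖B‖ < ε ∧ B - hop (Dt B) = B' := by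
  obtain ⟨hΨ, hΦΨ⟩ := phi_psi_of_norm_lt hC hC₂ hb hHop hq hRC hDball hDfix hB'
  refine ⟨B' + hop (Ct B'), ⟨hΨ, hΦΨ⟩, fun B hB => ?_⟩
  have hinj := injOn_phi_ball (hop := hop) hDfix
  exact hinj (mem_ball_zero_iff.mpr hB.1) (mem_ball_zero_iff.mpr hΨ) (hB.2.trans hΦΨ.symm)

omit [CompleteSpace 𝒳] in
/-- On the image: the constraint function at `B′ = Φ B` is the LINEAR function at `B` — `LQ̃B′ + C̃(B′) = LQ̃B`
with `B = Ψ B′` — so the δ-function `δ(LQ̃B′ + C̃(B′))` becomes `δ(LQ̃B)` (print: «yields the integral with the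
δ-function δ(Q̃B)»); pure algebra, §1. [folklore] -/
theorem constraint_eq_LQ_psi (hLQh : ∀ X, LQ (hop X) = X) (B' : 𝒴) :
    LQ B' + Ct B' = LQ (B' + hop (Ct B')) :=
  (LQ_psi hLQh B').symm

/-- **Invariant closed sets (e.g. the real configurations)**: if a closed set `S ∋ 0` of `𝒳` is mapped into
itself by `X ↦ C̃(B − hX)` on the ball `4C₂ε²`, then `D̃(B) ∈ S` — the contraction restricted to the complete set
`closedBall ∩ S` has a fixed point there, which is `D̃(B)` by uniqueness.  (With `S` = the real subspace and `Ct`,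
`hop` real for real arguments: `D̃` of a real `B` is real, so `Φ` is a change of REAL variables.) [folklore] -/
theorem Dt_mem_of_mapsTo (hC : QuadAnalytic Ct C₂ R) (hC₂ : 0 ≤ C₂) (hb : 0 ≤ b)
    (hHop : ∀ X, ‖hop X‖ ≤ b * ‖X‖) (hq : 9 * C₂ * b * ε < 1) (hRC : 3 * ε ≤ R)
    (hDball : ∀ B : 𝒴, ‖B‖ < ε → Dt B ∈ closedBall (0:𝒳) (4 * C₂ * ε ^ 2))
    (hDfix : ∀ B : 𝒴, ‖B‖ < ε → Ct (B - hop (Dt B)) = Dt B) {B : 𝒴} (hB : ‖B‖ < ε)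
    {S : Set 𝒳} (hS : IsClosed S) (h0S : (0:𝒳) ∈ S)
    (hmaps : ∀ X ∈ closedBall (0:𝒳) (4 * C₂ * ε ^ 2), X ∈ S → Ct (B - hop X) ∈ S) :
    Dt B ∈ S := by
  have hε : 0 < ε := (norm_nonneg _).trans_lt hB
  have hK0 : 0 ≤ 9 * C₂ * b * ε := by positivity
  have hR2 : 4 * C₂ * b * ε ≤ 1 := by nlinarith
  have hRC2 : 2 * ε ≤ R := by linarith
  set s := closedBall (0:𝒳) (4 * C₂ * ε ^ 2) ∩ S with hs
  have hmapsT : MapsTo (fun X => Ct (B - hop X)) s s := fun X hX =>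
    ⟨mapsTo_T hC hC₂ hb hHop hB hR2 hRC2 hX.1, hmaps X hX.1 hX.2⟩
  have hlip : ∀ X₁ ∈ s, ∀ X₂ ∈ s,
      ‖Ct (B - hop X₁) - Ct (B - hop X₂)‖ ≤ 9 * C₂ * b * ε * ‖X₁ - X₂‖ :=
    fun X₁ h₁ X₂ h₂ => lipschitz_T hC hC₂ hb hHop hB hR2 hRC h₁.1 h₂.1
  set K : NNReal := ⟨9 * C₂ * b * ε, hK0⟩ with hK
  have hcontr : ContractingWith K (hmapsT.restrict _ s s) := by
    refine ⟨?_, ?_⟩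
    · change (⟨9 * C₂ * b * ε, hK0⟩ : NNReal) < 1
      exact_mod_cast hq
    · refine LipschitzWith.of_dist_le_mul fun x y => ?_
      change dist (Ct (B - hop (x:𝒳))) (Ct (B - hop (y:𝒳))) ≤ (9 * C₂ * b * ε) * dist (x:𝒳) (y:𝒳)
      rw [dist_eq_norm, dist_eq_norm]
      exact hlip _ x.2 _ y.2
  have hsc : IsComplete s := (isClosed_closedBall.inter hS).isComplete
  have h0 : (0:𝒳) ∈ s := by
    refine ⟨?_, h0S⟩
    rw [mem_closedBall, dist_zero_right, norm_zero]; positivity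
  obtain ⟨Y, hYs, hfixY, -, -⟩ :=
    ContractingWith.exists_fixedPoint' hsc hmapsT hcontr h0 (edist_ne_top _ _)
  have hY : Y = Dt B := eq_Dt_of_fixedPt hC hC₂ hb hHop hq hRC hDball hDfix hB hYs.1 hfixY
  exact hY ▸ hYs.2

end fixedPoint

/-! ## §3  Analyticity along complex lines; the smallness arithmetic -/

section analytic

variable {𝒳 𝒴 : Type*} [NormedAddCommGroup 𝒳] [NormedSpace ℂ 𝒳] [CompleteSpace 𝒳]
  [NormedAddCommGroup 𝒴] [NormedSpace ℂ 𝒴]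
  {hop : 𝒳 →ₗ[ℂ] 𝒴} {Ct : 𝒴 → 𝒳} {C₂ R b ε : ℝ} {Dt : 𝒴 → 𝒳}

/-- **«it is an analytic function of B» — along every complex line**: for `C̃` Fréchet-holomorphic on
`{Y : ‖Y‖ < R}` (the form of `B11Prop6Scheme.Prop4Hyp.differentiableOn`; on the finite lattice «analytic» is
holomorphy on an open subset of a finite-dimensional complex space), the map `σ ↦ D̃(P + σQ)` is holomorphic on
the open set `{σ ∈ ℂ : ‖P + σQ‖ < ε}`.  Proof: `B13Contraction113.analytic_fixedPoint_113` (successive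
approximations converge locally uniformly) applied to the family `σ ↦ (h, P + σQ)` — its hypothesis `han` is the
chain rule here, the curve `σ ↦ P + σQ − h g(σ)` staying in `‖·‖ < 2ε ≤ R` — gives a holomorphic fixed-point
selection in the ball, which coincides with `D̃(P + σQ)` by uniqueness.  (Joint analyticity in `B` is not typed.)
[folklore] -/
theorem differentiableOn_Dt_line (hC : QuadAnalytic Ct C₂ R) (hC₂ : 0 ≤ C₂) (hb : 0 ≤ b)
    (hHop : ∀ X, ‖hop X‖ ≤ b * ‖X‖) (hq : 9 * C₂ * b * ε < 1) (hRC : 3 * ε ≤ R)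
    (hCd : DifferentiableOn ℂ Ct {Y : 𝒴 | ‖Y‖ < R})
    (hDball : ∀ B : 𝒴, ‖B‖ < ε → Dt B ∈ closedBall (0:𝒳) (4 * C₂ * ε ^ 2))
    (hDfix : ∀ B : 𝒴, ‖B‖ < ε → Ct (B - hop (Dt B)) = Dt B) (P Q : 𝒴) :
    DifferentiableOn ℂ (fun σ : ℂ => Dt (P + σ • Q)) {σ : ℂ | ‖P + σ • Q‖ < ε} := by
  set V : Set ℂ := {σ : ℂ | ‖P + σ • Q‖ < ε} with hV
  have hcont : Continuous fun σ : ℂ => P + σ • Q := continuous_const.add (continuous_id.smul continuous_const)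
  have hVo : IsOpen V := isOpen_lt hcont.norm continuous_const
  -- the bounded linear `hop` as a continuous linear map
  set hopL : 𝒳 →L[ℂ] 𝒴 := hop.mkContinuous b (fun X => hHop X) with hhopL
  have hhopL_apply : ∀ X, hopL X = hop X := fun X => rfl
  have han : ∀ g : ℂ → 𝒳, DifferentiableOn ℂ g V → MapsTo g V (closedBall (0:𝒳) (4 * C₂ * ε ^ 2)) →
      DifferentiableOn ℂ (fun σ => Ct (P + σ • Q - hop (g σ))) V := by
    intro g hg hgmaps
    have h1 : DifferentiableOn ℂ (fun σ : ℂ => P + σ • Q - hopL (g σ)) V :=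
      ((differentiable_id.smul_const Q).const_add P).differentiableOn.sub
        (hopL.differentiable.comp_differentiableOn hg)
    have h2 : MapsTo (fun σ : ℂ => P + σ • Q - hopL (g σ)) V {Y : 𝒴 | ‖Y‖ < R} := by
      intro σ hσ
      have hσ' : ‖P + σ • Q‖ < ε := hσ
      have hε : 0 ≤ ε := (norm_nonneg _).trans hσ'.le
      have h9 : 0 ≤ 9 * C₂ * b := by positivity
      have hR2 : 4 * C₂ * b * ε ≤ 1 := by nlinarith [mul_nonneg h9 hε]
      have hgn : ‖hop (g σ)‖ ≤ ε := norm_Hop_le hb hε hHop hR2 (hgmaps hσ)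
      show ‖P + σ • Q - hopL (g σ)‖ < R
      calc ‖P + σ • Q - hopL (g σ)‖ ≤ ‖P + σ • Q‖ + ‖hopL (g σ)‖ := norm_sub_le _ _
        _ < ε + ε := add_lt_add_of_lt_of_le hσ' (by rw [hhopL_apply]; exact hgn)
        _ ≤ R := by linarith
    exact (hCd.comp h1 h2).congr fun σ _ => rfl
  obtain ⟨Xs, hXd, hXs⟩ := analytic_fixedPoint_113 (Hσ := fun _ => hop) (Aσ := fun σ => P + σ • Q)
    hC hC₂ hb hVo (fun σ _ X => hHop X) (fun σ hσ => hσ) hq hRC han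
  refine hXd.congr fun σ hσ => ?_
  obtain ⟨-, -, huniq, -⟩ := hXs σ hσ
  exact huniq (Dt (P + σ • Q)) (hDball _ hσ) (hDfix _ hσ)

/-- **The smallness arithmetic** ([15] p. 286 «for example we take 9C₂B₀ε₃ ≦ 1/2, i.e. ε₃ ≦ (18C₂B₀)⁻¹»; cell
GAPS G-adv9-22 (U3) `ε₃′ ≤ (18C₂′B₀′)⁻¹`): `18C₂bε ≤ 1` implies the contraction condition `9C₂bε < 1` and the
self-map condition `4C₂bε ≤ 1` (`B13Contraction113.contraction_constant`). [folklore] -/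
theorem smallness_of_le (C₂ b ε : ℝ) (h18 : 18 * C₂ * b * ε ≤ 1) :
    9 * C₂ * b * ε < 1 ∧ 4 * C₂ * b * ε ≤ 1 := by
  obtain ⟨-, h2, h3⟩ := contraction_constant C₂ b ε
  exact ⟨(h2 h18).trans_lt (by norm_num), h3 h18⟩

end analytic

/-! ## §4  The p. 267 paragraph, assembled (transcription) -/

section transcription

variable {𝒳 𝒴 : Type*} [NormedAddCommGroup 𝒳] [NormedSpace ℂ 𝒳] [CompleteSpace 𝒳]
  [NormedAddCommGroup 𝒴] [NormedSpace ℂ 𝒴]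

/-- **B12 p. 267, the linearizing change of variables, in the typing of this file.**  *«We are looking for an
analytic, 𝐠-valued function D̃(B′), defined at bonds of T⁽ᵏ⁺¹⁾, and such that the transformation B′ = B − hD̃(B)
linearizes the function Q̃(B′). The function D̃(B) is determined by the equation LQ̃B′ + C̃(B′) = LQ̃B − D̃(B) +
C̃(B − hD̃(B)) = LQ̃B. It is easy to prove, following the proofs in the above mentioned papers, that there exists
exactly one solution of this equation, and that it is an analytic function of B. From this equation we obtain also
that D̃(B) has an expansion beginning with quadratic terms, and D̃⁽²⁾(B) = C̃⁽²⁾(B).»*  Given `LQ̃h = I`, the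
quadratic bound and line-analyticity of `C̃` on `‖Y‖ < R` (`QuadAnalytic`), `‖h‖ ≤ b`, `9C₂bε < 1`, `3ε ≤ R`:
there is `D̃` on `‖B‖ < ε` with values in the ball `4C₂ε²` solving the equation, for which the substitution
linearizes, `‖D̃(B)‖ ≤ 4C₂‖B‖²`, `‖D̃(B) − C̃(B)‖ ≤ 36C₂²b‖B‖³`; it is the ONLY solution in the ball; `Φ B = B −
hD̃(B)` is injective on `‖B‖ < ε`, and every `‖B′‖ < ε/2` equals `Φ(B′ + hC̃(B′))` with `‖B′ + hC̃(B′)‖ < ε`.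
Analyticity along complex lines: `differentiableOn_Dt_line` (under Fréchet-holomorphy of `C̃`).  A transcription
of the printed claims onto the kernel scheme `B13Contraction113`; nothing of [B12] beyond it is asserted.
[cite: Balaban1987RG1, p.267] -/
theorem p267_linearizing_change_of_variables {LQ : 𝒴 →ₗ[ℂ] 𝒳} {hop : 𝒳 →ₗ[ℂ] 𝒴} {Ct : 𝒴 → 𝒳}
    {C₂ R b ε : ℝ} (hLQh : ∀ X, LQ (hop X) = X) (hC : QuadAnalytic Ct C₂ R) (hC₂ : 0 ≤ C₂) (hb : 0 ≤ b)
    (hHop : ∀ X, ‖hop X‖ ≤ b * ‖X‖) (hq : 9 * C₂ * b * ε < 1) (hRC : 3 * ε ≤ R) :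
    ∃ Dt : 𝒴 → 𝒳,
      (∀ B : 𝒴, ‖B‖ < ε →
        Dt B ∈ closedBall (0:𝒳) (4 * C₂ * ε ^ 2) ∧ Ct (B - hop (Dt B)) = Dt B ∧
        LQ (B - hop (Dt B)) + Ct (B - hop (Dt B)) = LQ B ∧
        ‖Dt B‖ ≤ 4 * C₂ * ‖B‖ ^ 2 ∧ ‖Dt B - Ct B‖ ≤ 36 * C₂ ^ 2 * b * ‖B‖ ^ 3) ∧
      (∀ B : 𝒴, ‖B‖ < ε → ∀ X ∈ closedBall (0:𝒳) (4 * C₂ * ε ^ 2), Ct (B - hop X) = X → X = Dt B) ∧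
      InjOn (fun B => B - hop (Dt B)) (ball (0:𝒴) ε) ∧
      (∀ B' : 𝒴, ‖B'‖ < ε / 2 →
        ‖B' + hop (Ct B')‖ < ε ∧ (B' + hop (Ct B')) - hop (Dt (B' + hop (Ct B'))) = B') := by
  obtain ⟨Dt, hDt⟩ := exists_Dt hC hC₂ hb hHop hq hRC
  have hDball : ∀ B : 𝒴, ‖B‖ < ε → Dt B ∈ closedBall (0:𝒳) (4 * C₂ * ε ^ 2) := fun B hB => (hDt B hB).1
  have hDfix : ∀ B : 𝒴, ‖B‖ < ε → Ct (B - hop (Dt B)) = Dt B := fun B hB => (hDt B hB).2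
  refine ⟨Dt, fun B hB => ⟨hDball B hB, hDfix B hB, linearizes_Dt hLQh hDfix hB,
      norm_Dt_le hC hC₂ hb hHop hq hRC hDball hDfix hB,
      norm_Dt_sub_Ct_le hC hC₂ hb hHop hq hRC hDball hDfix hB⟩,
    fun B hB X hX hXfix => eq_Dt_of_fixedPt hC hC₂ hb hHop hq hRC hDball hDfix hB hX hXfix,
    injOn_phi_ball hDfix,
    fun B' hB' => phi_psi_of_norm_lt hC hC₂ hb hHop hq hRC hDball hDfix hB'⟩

/-- Non-vacuity of the hypothesis set of the transcription theorem: the degenerate model `𝒳 = 𝒴 = ℂ`,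
`LQ̃ = h = id`, `C̃ = 0`, `C₂ = 0`, `b = 1`, `ε = 1`, `R = 3` satisfies all seven hypotheses. [folklore] -/
example := p267_linearizing_change_of_variables (𝒳 := ℂ) (𝒴 := ℂ) (LQ := LinearMap.id) (hop := LinearMap.id)
  (Ct := fun _ => 0) (C₂ := 0) (R := 3) (b := 1) (ε := 1) (fun _ => rfl)
  ⟨fun Y _ => by simp, fun P Q => differentiableOn_const (0:ℂ)⟩ le_rfl zero_le_one (fun X => by simp)
  (by norm_num) (by norm_num)

end transcription

end Literature.MathematicalPhysics.QuantumFieldTheory.Balaban1983to89.B12Lineariz267
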